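import Literature.NumberTheory.EllipticCurves.YanZhu2026.GreenbergMainTheoremsAnyRoot
import HarnessLib

/-!
# Burungale–Castella–Skinner 2025, Theorem 4.1.3 — the EQUIVALENCE of the ordinary and the Greenberg
# two-variable main conjectures for `E/K`, WITH the torsion clauses (named fact) + its torsion transfers

Source: A. Burungale, F. Castella, C. Skinner, *Base change and Iwasawa main conjectures for GL₂*,
IMRN 2025 no. 8, rnaf082 = arXiv:2405.00270v2 (REFEREED; bib key `BurungaleCastellaSkinner2025`), §4.1
Thm. 4.1.3 (p. 8, `[corpus: paper:arxiv-2405.00270 p0008 L25–L51]`).  Cell `pub/bsd-littype`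
(literature-typing layer, D-0088(4)), seat `bsd-littype-03` gen 4, sheet `staging/bsd-littype-03/SHEETS-03.md`
§8 — closes the located typing gap OQ-14 of `OPEN-QUESTIONS-03.md`: the tree's transcription of the
Beilinson–Flach equivalence, `YanZhu2026.thm47_ord_localised_iff_greenbergAnyRoot_localised` (Yan–Zhu
Thm. 4.7), transports the two DIVISIBILITIES between the ordinary and the Greenberg side for every
multiplicative set `S = {sⁿ}` but — faithfully to Yan–Zhu's print — NOT the `Λ_K`-torsion-ness of the
Selmer duals (its docstring: "Not transcribed, as not printed in Thm. 4.7: 'X_ord torsion ⟺ X_Gr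
torsion', which [BCS, Prop. 4.1.3] prints").  BCS Thm. 4.1.3 prints the equivalence WITH the torsion
clauses, for `S = {pⁿ}` ("in `Λ_K ⊗ ℚ_p`" / "in `Λ_K^ur ⊗ ℚ_p`") and for `S = {1}` ("before inverting
`p`"), in both directions of divisibility.  It is vendored here verbatim in the currency of `thm47_…AnyRoot_…`
(same binders, same frames, same localisation bookkeeping (T8)), restricted to `s ∈ {1, p}` as printed.

presearch: BCS Thm 4.1.3 (torsion-coupled equivalence) → [corpus: paper:arxiv-2405.00270 p.8] the
source itself (hybrid search; neighbours Delbourgo 2008, Hida 2000, Ochiai 2006 do not state it);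
[galaxy:pdf] "Beilinson-Flach|two-variable main conjecture|Greenberg Selmer" → Rankin–Eisenstein /
Coleman-family papers, no restatement; printed proof = [BSTW24, §9.3.2 / Prop. 9.18] (preprint),
cf. [CGS23, Prop. 3.2.1].

## The printed statement (verbatim)

> **Theorem 4.1.3.** Let `g ∈ S₂(Γ₀(N))` be an elliptic newform, and `p ∤ 2N` an ordinary prime for
> `g`. Let `K` be an imaginary quadratic field satisfying (spl), `(D_K, N) = 1`, and (irr_K). Then the
> following are equivalent:
> (i) `X_ord(g/K_∞)` is `Λ_K`-torsion, with `(L_p^PR(g/K)) ⊃ ch_{Λ_K}(X_ord(g/K_∞))` in `Λ_K ⊗ ℚ_p`.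
> (ii) `X_Gr(g/K_∞)` is `Λ_K`-torsion, with `(L_p^Gr(g/K)) ⊃ ch_{Λ_K}(X_Gr(g/K_∞))` in `Λ_K^ur ⊗ ℚ_p`.
> The same conclusion holds for the opposite divisibilities, and before inverting `p`. In particular,
> Conjecture 4.1.1 and Conjecture 4.1.2 are equivalent.
> *Proof.* This is shown in [BSTW23, §9.3.2] (cf. [CGS23, Prop. 3.2.1] or [Cas24, §3.3]) building on
> a pair of four-term exact sequences coming from Poitou–Tate duality. □

## Transcription (tree vocabulary only; every carrier cited by name, none re-declared)

Exactly the currency of `YanZhu2026.thm47_ord_localised_iff_greenbergAnyRoot_localised` ((T1)–(T8),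
(D1)–(D2) of `YanZhu2026/GreenbergMainTheoremsAnyRoot.lean`): `g = f_E` for `E = W/ℚ` globally minimal
with modular parametrisation `π : ModularParametrizationData W N` (`N = N_E` through `GreenbergSetting.level`);
all standing data packaged as `YanZhu2026.GreenbergSetting ι W N K v v̄ κ₁ κ₂` (good ORDINARY `p > 2` —
print: "`p ∤ 2N` ordinary" ✓ —, `K` imaginary quadratic, (spl) with `v` induced by `ι`, `(N, D_K) = 1`
✓, and ALSO (disc): `D_K` odd, `≠ −3`, which Thm. 4.1.3 does not print — WEAKER) + (irr_K) =
`(W.baseChange K).HasIrreducibleModPGaloisRep p` + `ι₁` compatible with `ι`; `X_ord(g/K_∞) =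
(W.baseChange K).XOrd₂ p κ₁ κ₂ γ₁ γ₂`, `X_Gr(g/K_∞) = (W.baseChange K).XGr₂ p κ₁ κ₂ v̄ γ₁ γ₂` over
`Λ_K = IwasawaAlgebra₂ p` with an adapted generator pair `(γ₁, γ₂)` of (cyc, anti) `(κ₁, κ₂)`;
`L_p^PR(g/K) = perrinRiouLFunction W π F` for a type-I frame `F`; `L_p^Gr(g/K) = G` in the sound value
frame `IsGreenbergLFunctionAnyRoot₂ ι v v̄ κ₁ κ₂ γ₁⁻¹ γ₂⁻¹ π.f |D_K| h_K LK G` over a Katz frame `LK`;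
"in `Λ_K ⊗ ℚ_p`" / "in `Λ_K^ur ⊗ ℚ_p`" = the `S = {pⁿ}` localisation (`s = p`), "before inverting `p`" =
`s = 1`, in the one-generator bookkeeping (T8): `IdealLeSpanAway s`, `SpanLeIdealAway s` on the ordinary
side, `∃ n, (J s)ⁿ · _ ≤ _` on the extended ideals `charIdeal.map (toUnr₂ p J)` along a
structure-compatible `J : ℤ_p → 𝒪_{ℂ_p}` on the Greenberg side.  "`Λ_K`-torsion" = `Module.IsTorsion
(IwasawaAlgebra₂ p) _` (as in `YanZhu2026.cor29_XOrd₂_isTorsion`, `thm42_…AnyRoot`).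
-- TODO(general form): every multiplicative set `S` (the tree's `thm47_…AnyRoot_…` has the divisibility halves for every `s ≠ 0`; print's Thm. 4.1.3 only `S = {pⁿ}` and `S = {1}`); elliptic newforms `g` are exactly the `f_E` — no loss there; drop (disc) once `L_p^Gr` has a carrier outside the §3.5 setting of [YZ26].

## References
* [BurungaleCastellaSkinner2025] IMRN 2025 rnaf082 = arXiv:2405.00270v2: Thm. 4.1.3 (p. 8) with §4
  standing line (p. 7 L52–L60); statements 4.1.1 / 4.1.2.
* [BurungaleSkinnerTianWan2024] arXiv:2409.01350v2, §9.3.2 / Prop. 9.18 (the printed proof).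
* [CastellaGrossiSkinner2025] Math. Ann. 393 (2025), Prop. 3.2.1 (cf.).
* [YanZhu2024MainConjNonCM] J. Algebra 693 (2026) = arXiv:2412.20078v4, Thm. 4.7 (the currency).
-/

noncomputable section

open scoped Classical

open PowerSeries NumberField IsDedekindDomain Field CongruenceSubgroup
  Literature.NumberTheory.GaloisRepresentations Literature.NumberTheory.EllipticCurves
  Literature.NumberTheory.EllipticCurves.ModularForms Literature.NumberTheory.EllipticCurves.Rank1Residual
  Literature.NumberTheory.EllipticCurves.IwasawaAlgebra₂ Literature.NumberTheory.EllipticCurves.YanZhu2026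

namespace Literature.NumberTheory.EllipticCurves.BurungaleCastellaSkinner2025

/-! ## Theorem 4.1.3 (named fact) -/

/-- **Burungale–Castella–Skinner, IMRN 2025 (rnaf082) = arXiv:2405.00270v2, Theorem 4.1.3 (§4.1, p. 8) —
the ordinary statement 4.1.1 and the Greenberg statement 4.1.2 are EQUIVALENT, torsion clauses included.**
Verbatim in the module docstring: for an elliptic newform `g`, `p ∤ 2N` ordinary, `K` imaginary
quadratic with (spl), `(D_K, N) = 1`, (irr_K): (i) [`X_ord(g/K_∞)` is `Λ_K`-torsion with
`(L_p^PR(g/K)) ⊃ ch(X_ord(g/K_∞))` in `Λ_K ⊗ ℚ_p`] ⟺ (ii) [`X_Gr(g/K_∞)` is `Λ_K`-torsion with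
`(L_p^Gr(g/K)) ⊃ ch(X_Gr(g/K_∞))` in `Λ_K^ur ⊗ ℚ_p`]; "The same conclusion holds for the opposite
divisibilities, and before inverting `p`."  TRANSCRIBED (module docstring) for `g = f_E`, `E = W`
under `GreenbergSetting` (WEAKER: also (disc)), (irr_K) and `ι₁` compatible with `ι`, in the currency of
`YanZhu2026.thm47_ord_localised_iff_greenbergAnyRoot_localised`: for every type-I frame `F`, every
Katz frame `LK` with a Greenberg series `G` of `f_E` in the sound value frame, every structure-compatible
`J`, and `s ∈ {1, p}` (print: "before inverting `p`" / "in `⊗ ℚ_p`"):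
`[X_ord torsion ∧ S⁻¹ch(X_ord) ⊂ (L^PR)] ↔ [X_Gr torsion ∧ ∃ n, J(s)ⁿ·ch(X_Gr)𝒪_{ℂ_p}⟦T₁,T₂⟧ ⊆ (G)]`
AND `[X_ord torsion ∧ S⁻¹(L^PR) ⊂ S⁻¹ch(X_ord)] ↔ [X_Gr torsion ∧ ∃ n, J(s)ⁿ·(G) ⊆ ch(X_Gr)𝒪_{ℂ_p}⟦T₁,T₂⟧]`.
(The divisibility halves alone, for every `s ≠ 0`, are Yan–Zhu's Thm. 4.7 = `thm47_…AnyRoot_…`, which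
deliberately omits the torsion clauses; this fact is the printed BCS statement WITH them.)
[cite: BurungaleCastellaSkinner2025, Thm. 4.1.3 (§4.1, p. 8 of arXiv:2405.00270v2) with §4 standing (irr_K) (p. 7)]
[cite: BurungaleSkinnerTianWan2024, §9.3.2 / Prop. 9.18 (the printed proof: four-term Poitou–Tate sequences)]
[cite: YanZhu2024MainConjNonCM, Thm. 4.7 (arXiv:2412.20078v4 TeX l.1022–1034) (currency, (T8))] -/
def thm413_ord_torsion_dvd_iff_greenberg_torsion_dvd : Prop :=
  ∀ {p : ℕ} [Fact p.Prime] (ι₁ : integralClosure ℚ ℂ →+* ℂ_[p]) (ι : PadicAlgCl p ≃+* ℂ)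
    (W : WeierstrassCurve ℚ) [W.IsElliptic] [W.IsGloballyMinimal] (K : Type) [Field K] [NumberField K]
    (v vbar : HeightOneSpectrum (𝓞 K)) (κ₁ κ₂ : ZpExtension K p) (γ₁ γ₂ : absoluteGaloisGroup K)
    [Fact (ZpExtension.IsTopGeneratorPair κ₁ κ₂ γ₁ γ₂)] {N : ℕ} [NeZero N]
    (π : ModularParametrizationData W N) [NeZero (NumberField.discr K).natAbs],
    GreenbergSetting ι W N K v vbar κ₁ κ₂ → (W.baseChange K).HasIrreducibleModPGaloisRep p →
    (∀ z : integralClosure ℚ ℂ, ι₁ z = ((ι.symm (z : ℂ) : PadicAlgCl p) : ℂ_[p])) →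
    ∀ F : CycAntiSeries p, IsHidaRankinLFunction ι₁ W κ₁ κ₂ π.f F → IsCongruenceIntegral π.f F →
    ∀ (Ω δ : ℂ) (Ωp : (unrIntegers p)ˣ) (LK G : PowerSeries (PowerSeries (PadicComplexInt p))),
      IsKatzMeasure₂ ι v vbar ∅ κ₁ κ₂ γ₁⁻¹ γ₂⁻¹ 1 Ω δ ((Ωp : unrIntegers p) : ℂ_[p]) LK →
      IsGreenbergLFunctionAnyRoot₂ ι v vbar κ₁ κ₂ γ₁⁻¹ γ₂⁻¹ π.f (NumberField.discr K).natAbs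
        (NumberField.classNumber K) LK G →
    ∀ J : ℤ_[p] →+* PadicComplexInt p,
      (∀ x : ℤ_[p], ((J x : PadicComplexInt p) : ℂ_[p]) = ((x : ℚ_[p]) : ℂ_[p])) →
    ∀ s : IwasawaAlgebra₂ p, (s = 1 ∨ s = (p : IwasawaAlgebra₂ p)) →
      ((Module.IsTorsion (IwasawaAlgebra₂ p) ((W.baseChange K).XOrd₂ p κ₁ κ₂ γ₁ γ₂) ∧
          IdealLeSpanAway s (WeierstrassCurve.XOrd₂.charIdeal (W.baseChange K) p κ₁ κ₂ γ₁ γ₂)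
            (perrinRiouLFunction W π F)) ↔
        (Module.IsTorsion (IwasawaAlgebra₂ p) ((W.baseChange K).XGr₂ p κ₁ κ₂ vbar γ₁ γ₂) ∧
          ∃ n : ℕ, Ideal.span {toUnr₂ p J s ^ n} *
              (WeierstrassCurve.XGr₂.charIdeal (W.baseChange K) p κ₁ κ₂ vbar γ₁ γ₂).map (toUnr₂ p J) ≤
            Ideal.span {G})) ∧
      ((Module.IsTorsion (IwasawaAlgebra₂ p) ((W.baseChange K).XOrd₂ p κ₁ κ₂ γ₁ γ₂) ∧
          SpanLeIdealAway s (perrinRiouLFunction W π F)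
            (WeierstrassCurve.XOrd₂.charIdeal (W.baseChange K) p κ₁ κ₂ γ₁ γ₂)) ↔
        (Module.IsTorsion (IwasawaAlgebra₂ p) ((W.baseChange K).XGr₂ p κ₁ κ₂ vbar γ₁ γ₂) ∧
          ∃ n : ℕ, Ideal.span {toUnr₂ p J s ^ n} * Ideal.span {G} ≤
            (WeierstrassCurve.XGr₂.charIdeal (W.baseChange K) p κ₁ κ₂ vbar γ₁ γ₂).map (toUnr₂ p J)))

/-! ## The two torsion transfers (PROVED from the fact) — what `thm47_…AnyRoot_…` does not give -/

section Transfers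

variable {p : ℕ} [Fact p.Prime] {K : Type} [Field K] [NumberField K]
  (ι₁ : integralClosure ℚ ℂ →+* ℂ_[p]) (ι : PadicAlgCl p ≃+* ℂ) (W : WeierstrassCurve ℚ)
  [W.IsElliptic] [W.IsGloballyMinimal] (v vbar : HeightOneSpectrum (𝓞 K)) (κ₁ κ₂ : ZpExtension K p)
  (γ₁ γ₂ : absoluteGaloisGroup K) [Fact (ZpExtension.IsTopGeneratorPair κ₁ κ₂ γ₁ γ₂)] {N : ℕ}
  [NeZero N] (π : ModularParametrizationData W N) [NeZero (NumberField.discr K).natAbs]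

/-- **`X_ord` torsion + the integral ordinary divisibility `ch(X_ord) ⊂ (L_p^PR)` ⟹ `X_Gr` is
`Λ_K`-torsion** (Thm. 4.1.3, (i) ⟹ (ii), "before inverting `p`", torsion clause) — granted the fact,
under its hypotheses, for any Katz/Greenberg frame and compatible `J`.
[cite: BurungaleCastellaSkinner2025, Thm. 4.1.3 (§4.1, p. 8 of arXiv:2405.00270v2)] -/
theorem xGr₂_isTorsion_of_thm413 (h413 : thm413_ord_torsion_dvd_iff_greenberg_torsion_dvd)
    (hS : GreenbergSetting ι W N K v vbar κ₁ κ₂) (hirrK : (W.baseChange K).HasIrreducibleModPGaloisRep p)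
    (hι : ∀ z : integralClosure ℚ ℂ, ι₁ z = ((ι.symm (z : ℂ) : PadicAlgCl p) : ℂ_[p]))
    {F : CycAntiSeries p} (hF : IsHidaRankinLFunction ι₁ W κ₁ κ₂ π.f F) (hc : IsCongruenceIntegral π.f F)
    {Ω δ : ℂ} {Ωp : (unrIntegers p)ˣ} {LK G : PowerSeries (PowerSeries (PadicComplexInt p))}
    (hLK : IsKatzMeasure₂ ι v vbar ∅ κ₁ κ₂ γ₁⁻¹ γ₂⁻¹ 1 Ω δ ((Ωp : unrIntegers p) : ℂ_[p]) LK)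
    (hG : IsGreenbergLFunctionAnyRoot₂ ι v vbar κ₁ κ₂ γ₁⁻¹ γ₂⁻¹ π.f (NumberField.discr K).natAbs
      (NumberField.classNumber K) LK G)
    {J : ℤ_[p] →+* PadicComplexInt p}
    (hJ : ∀ x : ℤ_[p], ((J x : PadicComplexInt p) : ℂ_[p]) = ((x : ℚ_[p]) : ℂ_[p]))
    (htor : Module.IsTorsion (IwasawaAlgebra₂ p) ((W.baseChange K).XOrd₂ p κ₁ κ₂ γ₁ γ₂))
    (hle : IdealLeSpan (WeierstrassCurve.XOrd₂.charIdeal (W.baseChange K) p κ₁ κ₂ γ₁ γ₂)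
      (perrinRiouLFunction W π F)) :
    Module.IsTorsion (IwasawaAlgebra₂ p) ((W.baseChange K).XGr₂ p κ₁ κ₂ vbar γ₁ γ₂) :=
  (((h413 ι₁ ι W K v vbar κ₁ κ₂ γ₁ γ₂ π hS hirrK hι F hF hc Ω δ Ωp LK G hLK hG J hJ 1 (Or.inl rfl)).1).mp
    ⟨htor, hle.away 1⟩).1

/-- **`X_Gr` torsion + the integral Greenberg divisibility `ch(X_Gr)𝒪_{ℂ_p}⟦T₁,T₂⟧ ⊆ (L_p^Gr)` ⟹ `X_ord`
is `Λ_K`-torsion** (Thm. 4.1.3, (ii) ⟹ (i), "before inverting `p`", torsion clause) — granted the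
fact, under its hypotheses, for any type-I frame `F`.
[cite: BurungaleCastellaSkinner2025, Thm. 4.1.3 (§4.1, p. 8 of arXiv:2405.00270v2)] -/
theorem xOrd₂_isTorsion_of_thm413 (h413 : thm413_ord_torsion_dvd_iff_greenberg_torsion_dvd)
    (hS : GreenbergSetting ι W N K v vbar κ₁ κ₂) (hirrK : (W.baseChange K).HasIrreducibleModPGaloisRep p)
    (hι : ∀ z : integralClosure ℚ ℂ, ι₁ z = ((ι.symm (z : ℂ) : PadicAlgCl p) : ℂ_[p]))
    {F : CycAntiSeries p} (hF : IsHidaRankinLFunction ι₁ W κ₁ κ₂ π.f F) (hc : IsCongruenceIntegral π.f F)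
    {Ω δ : ℂ} {Ωp : (unrIntegers p)ˣ} {LK G : PowerSeries (PowerSeries (PadicComplexInt p))}
    (hLK : IsKatzMeasure₂ ι v vbar ∅ κ₁ κ₂ γ₁⁻¹ γ₂⁻¹ 1 Ω δ ((Ωp : unrIntegers p) : ℂ_[p]) LK)
    (hG : IsGreenbergLFunctionAnyRoot₂ ι v vbar κ₁ κ₂ γ₁⁻¹ γ₂⁻¹ π.f (NumberField.discr K).natAbs
      (NumberField.classNumber K) LK G)
    {J : ℤ_[p] →+* PadicComplexInt p}
    (hJ : ∀ x : ℤ_[p], ((J x : PadicComplexInt p) : ℂ_[p]) = ((x : ℚ_[p]) : ℂ_[p]))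
    (htor : Module.IsTorsion (IwasawaAlgebra₂ p) ((W.baseChange K).XGr₂ p κ₁ κ₂ vbar γ₁ γ₂))
    (hle : (WeierstrassCurve.XGr₂.charIdeal (W.baseChange K) p κ₁ κ₂ vbar γ₁ γ₂).map (toUnr₂ p J) ≤
      Ideal.span {G}) :
    Module.IsTorsion (IwasawaAlgebra₂ p) ((W.baseChange K).XOrd₂ p κ₁ κ₂ γ₁ γ₂) := by
  have h := (h413 ι₁ ι W K v vbar κ₁ κ₂ γ₁ γ₂ π hS hirrK hι F hF hc Ω δ Ωp LK G hLK hG J hJ 1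
    (Or.inl rfl)).1
  have hle' : ∃ n : ℕ, Ideal.span {toUnr₂ p J 1 ^ n} *
      (WeierstrassCurve.XGr₂.charIdeal (W.baseChange K) p κ₁ κ₂ vbar γ₁ γ₂).map (toUnr₂ p J) ≤
        Ideal.span {G} := by
    rw [map_one, exists_span_one_pow_mul_le_iff]
    exact hle
  exact (h.mpr ⟨htor, hle'⟩).1

/-- **Consistency with Yan–Zhu Thm. 4.7 (the divisibility halves)**: granted BOTH facts, at `s = 1` the
divisibility clause of Thm. 4.1.3 (i) ⟹ (ii) agrees with `thm47_…AnyRoot_…`'s — the BCS fact adds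
exactly the torsion transfer. (A sanity edge: the two facts speak the same currency.)
[cite: BurungaleCastellaSkinner2025, Thm. 4.1.3 (§4.1, p. 8 of arXiv:2405.00270v2)]
[cite: YanZhu2024MainConjNonCM, Thm. 4.7 (arXiv:2412.20078v4 TeX l.1022–1034)] -/
theorem greenberg_dvd_of_thm47AnyRoot_of_idealLeSpan
    (h47 : thm47_ord_localised_iff_greenbergAnyRoot_localised)
    (hS : GreenbergSetting ι W N K v vbar κ₁ κ₂) (hirrK : (W.baseChange K).HasIrreducibleModPGaloisRep p)
    (hι : ∀ z : integralClosure ℚ ℂ, ι₁ z = ((ι.symm (z : ℂ) : PadicAlgCl p) : ℂ_[p]))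
    {F : CycAntiSeries p} (hF : IsHidaRankinLFunction ι₁ W κ₁ κ₂ π.f F) (hc : IsCongruenceIntegral π.f F)
    {Ω δ : ℂ} {Ωp : (unrIntegers p)ˣ} {LK G : PowerSeries (PowerSeries (PadicComplexInt p))}
    (hLK : IsKatzMeasure₂ ι v vbar ∅ κ₁ κ₂ γ₁⁻¹ γ₂⁻¹ 1 Ω δ ((Ωp : unrIntegers p) : ℂ_[p]) LK)
    (hG : IsGreenbergLFunctionAnyRoot₂ ι v vbar κ₁ κ₂ γ₁⁻¹ γ₂⁻¹ π.f (NumberField.discr K).natAbs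
      (NumberField.classNumber K) LK G)
    {J : ℤ_[p] →+* PadicComplexInt p}
    (hJ : ∀ x : ℤ_[p], ((J x : PadicComplexInt p) : ℂ_[p]) = ((x : ℚ_[p]) : ℂ_[p]))
    (hle : IdealLeSpan (WeierstrassCurve.XOrd₂.charIdeal (W.baseChange K) p κ₁ κ₂ γ₁ γ₂)
      (perrinRiouLFunction W π F)) :
    (WeierstrassCurve.XGr₂.charIdeal (W.baseChange K) p κ₁ κ₂ vbar γ₁ γ₂).map (toUnr₂ p J) ≤
      Ideal.span {G} := by
  have h := ((h47 ι₁ ι W K v vbar κ₁ κ₂ γ₁ γ₂ π hS hirrK hι F hF hc Ω δ Ωp LK G hLK hG J hJ 1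
    one_ne_zero).1).mp (hle.away 1)
  rw [map_one, exists_span_one_pow_mul_le_iff] at h
  exact h

end Transfers

end Literature.NumberTheory.EllipticCurves.BurungaleCastellaSkinner2025

end
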